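import Mathlib
import Summits.MatrixMultiplication.MatrixMultiplication.Theorems.SnSubsetDichotomyPolynomialSlackHubMassValue
import Summits.MatrixMultiplication.MatrixMultiplication.Theorems.SnSubsetDichotomyPolynomialSlackBlockCounts
import Summits.MatrixMultiplication.MatrixMultiplication.Theorems.SnSubsetDichotomyPolynomialSlackDyadicLevels

/-!
# Atom data: bookkeeping lemmas of the atom endgame

Crux `Summit.MatrixMultiplication.MatrixMultiplication.Theses.SnSubsetDichotomy.PolynomialSlack`
(item `stmt-MatrixMultiplication-8306`), line transport-split-hull (lead c9), stub group "AtomData".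

The all-split endgame works with ATOMS at a hub position `k` of `U`: the dyadic level blocks
`J_{k,a} = {j : θ ≤ d(j,k), ⌊log₂(1/d(j,k))⌋₊ = a}` of the heavy column of a quotient profile.
This file records six small bookkeeping facts about them:

* `levelBlock_flat` — a level block is flat within a factor `2`:
  `max((1/2)^{a+1}, θ) ≤ d j ≤ 2 · max((1/2)^{a+1}, θ)` on the block;
* `sum_heavy_eq_sum_levels` — every heavy cell (`d j ≥ θ ≥ 1/n²`) has a level
  `≤ ⌊log₂ n²⌋₊`, so a sum over the heavy cells splits as a sum over the level blocks;
* `blockMass_eq_sum_mu` — block masses are `μ`-averages of pull-back probabilities: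
  `Σ_{j ∈ J} m_{TU}(j,k)/(|T||U|) = Σ_v P_U(u k = v) · P_T(t⁻¹ v ∈ J)`;
* `sum_pullback_le_one` — for pairwise disjoint blocks `J a`, the pull-back probabilities
  `P_T(t⁻¹ v ∈ J a)` form a sub-partition of unity;
* `budget_of_subpartitions` — the mass budget of two sub-partitions of unity `X, Y` against a
  probability vector `μ`: `Σ_P μX + Σ_Q μY ≤ 1 + Σ_P Σ_Q μXY`;
* `hubMass_rowSum_le` — the row sums of the hub masses are bounded by the block masses:
  `Σ_b Σ_v μ X_a Y_b ≤ Σ_v μ X_a`.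
-/

namespace Summit.MatrixMultiplication.MatrixMultiplication.Theorems.PolynomialSlack

set_option linter.dupNamespace false

open scoped BigOperators

/-! ## Level blocks of a heavy column -/

/-- **Flatness of a dyadic level block.** If `0 < θ ≤ d j ≤ 1` and `⌊log₂(1/d j)⌋₊ = a`, then
`max((1/2)^{a+1}, θ) ≤ d j ≤ 2 · max((1/2)^{a+1}, θ)`: by the dyadic level bounds
`(1/2)^{a+1} < d j ≤ (1/2)^a = 2 · (1/2)^{a+1}`. [folklore] -/
theorem levelBlock_flat {n : ℕ} (d : Fin n → ℝ) (θ : ℝ) (hθ : 0 < θ) (hd1 : ∀ j, d j ≤ 1) (a : ℕ)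
    (j : Fin n)
    (hj : j ∈ Finset.univ.filter (fun j => θ ≤ d j ∧ ⌊Real.logb 2 (1 / d j)⌋₊ = a)) :
    max ((1 / 2 : ℝ) ^ (a + 1)) θ ≤ d j ∧ d j ≤ 2 * max ((1 / 2 : ℝ) ^ (a + 1)) θ := by
  rw [Finset.mem_filter] at hj
  obtain ⟨-, hθj, ha⟩ := hj
  have hpos : 0 < d j := lt_of_lt_of_le hθ hθj
  have hb := dyadicLevel_bounds (d j) hpos (hd1 j)
  rw [ha] at hb
  obtain ⟨hlo, hhi⟩ := hb
  refine ⟨max_le hlo.le hθj, ?_⟩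
  have h2 : (1 / 2 : ℝ) ^ a = 2 * (1 / 2 : ℝ) ^ (a + 1) := by
    rw [pow_succ]
    ring
  calc d j ≤ (1 / 2 : ℝ) ^ a := hhi
    _ = 2 * (1 / 2 : ℝ) ^ (a + 1) := h2
    _ ≤ 2 * max ((1 / 2 : ℝ) ^ (a + 1)) θ :=
        mul_le_mul_of_nonneg_left (le_max_left _ _) (by norm_num)

/-- **Heavy sums split over levels.** If `1/n² ≤ θ` and `d ≤ 1`, every heavy cell `j`
(`θ ≤ d j`) has dyadic level `⌊log₂(1/d j)⌋₊ ≤ ⌊log₂ n²⌋₊` (levels are antitone and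
`1/(1/n²) = n²`), so a sum over the heavy cells is the sum over the `⌊log₂ n²⌋₊ + 1` level
blocks of the heavy column (fibrewise summation). [folklore] -/
theorem sum_heavy_eq_sum_levels {n : ℕ} (hn : 1 ≤ n) (d : Fin n → ℝ) (θ : ℝ)
    (hθ : 1 / (n : ℝ) ^ 2 ≤ θ) (hd1 : ∀ j, d j ≤ 1) (f : Fin n → ℝ) :
    ∑ j ∈ Finset.univ.filter (fun j => θ ≤ d j), f j =
      ∑ a : Fin (⌊Real.logb 2 ((n : ℝ) ^ 2)⌋₊ + 1),
        ∑ j ∈ Finset.univ.filter (fun j => θ ≤ d j ∧ ⌊Real.logb 2 (1 / d j)⌋₊ = a.val), f j := by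
  classical
  have _ := hd1 -- only positivity of the heavy densities is used
  set Lm : ℕ := ⌊Real.logb 2 ((n : ℝ) ^ 2)⌋₊ with hLm_def
  have hn' : (0 : ℝ) < n := by exact_mod_cast hn
  have hn2 : (0 : ℝ) < 1 / (n : ℝ) ^ 2 := by positivity
  -- every heavy cell has level `≤ Lm`
  have hlev : ∀ j, θ ≤ d j → ⌊Real.logb 2 (1 / d j)⌋₊ ≤ Lm := by
    intro j hj
    have h := dyadicLevel_mono (d j) (1 / (n : ℝ) ^ 2) hn2 (hθ.trans hj)
    rwa [one_div_one_div] at h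
  -- the (truncated) level map into `Fin (Lm + 1)`
  let g : Fin n → Fin (Lm + 1) := fun j =>
    ⟨min ⌊Real.logb 2 (1 / d j)⌋₊ Lm, Nat.lt_succ_of_le (min_le_right _ _)⟩
  rw [← Finset.sum_fiberwise (Finset.univ.filter fun j => θ ≤ d j) g f]
  refine Finset.sum_congr rfl fun a _ => ?_
  rw [Finset.filter_filter]
  refine Finset.sum_congr ?_ fun _ _ => rfl
  refine Finset.filter_congr fun j _ => ?_
  constructor
  · rintro ⟨hθj, hg⟩
    refine ⟨hθj, ?_⟩
    have hg' : min ⌊Real.logb 2 (1 / d j)⌋₊ Lm = a.val := by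
      rw [← hg]
    rw [← hg', min_eq_left (hlev j hθj)]
  · rintro ⟨hθj, hl⟩
    refine ⟨hθj, ?_⟩
    apply Fin.ext
    show min ⌊Real.logb 2 (1 / d j)⌋₊ Lm = a.val
    rw [min_eq_left (hlev j hθj), hl]

/-! ## Block masses and pull-back probabilities -/

/-- **Block masses are `μ`-averages of pull-back probabilities.** For nonempty `T, U ⊆ S_n`,
a block `J` and a position `k`:
`Σ_{j ∈ J} #{(t,u) : u k = t j}/(|T|·|U|) = Σ_v (#{u : u k = v}/|U|) · (#{t : t⁻¹ v ∈ J}/|T|)`,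
the normalised form of the hub column mass identity `sum_pairMarginal_col_block_eq`. [folklore] -/
theorem blockMass_eq_sum_mu {n : ℕ} (T U : Finset (Equiv.Perm (Fin n))) (hT : T.Nonempty)
    (hU : U.Nonempty) (J : Finset (Fin n)) (k : Fin n) :
    ∑ j ∈ J, (((T ×ˢ U).filter fun tu => tu.2 k = tu.1 j).card : ℝ) / (T.card * U.card : ℕ) =
      ∑ v : Fin n, ((U.filter fun u => u k = v).card : ℝ) / U.card *
        (((T.filter fun t => t⁻¹ v ∈ J).card : ℝ) / T.card) := by
  classical
  have hTc : (0 : ℝ) < T.card := by exact_mod_cast hT.card_pos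
  have hUc : (0 : ℝ) < U.card := by exact_mod_cast hU.card_pos
  rw [← Finset.sum_div, ← Nat.cast_sum, sum_pairMarginal_col_block_eq T U J k, Nat.cast_sum,
    Finset.sum_div]
  refine Finset.sum_congr rfl fun v _ => ?_
  rw [div_mul_div_comm, Nat.cast_mul, Nat.cast_mul, mul_comm (T.card : ℝ) (U.card : ℝ)]

/-- **Pull-back probabilities form a sub-partition of unity.** For a nonempty `T ⊆ S_n`, pairwise
disjoint blocks `J a`, any finset `P` of block indices and any value `v`:
`Σ_{a ∈ P} #{t ∈ T : t⁻¹ v ∈ J a}/|T| ≤ 1`, since the events `{t⁻¹ v ∈ J a}` are pairwise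
disjoint subsets of `T`. [folklore] -/
theorem sum_pullback_le_one {n m : ℕ} (T : Finset (Equiv.Perm (Fin n))) (hT : T.Nonempty)
    (J : Fin m → Finset (Fin n)) (hJ : ∀ a a', a ≠ a' → Disjoint (J a) (J a'))
    (P : Finset (Fin m)) (v : Fin n) :
    ∑ a ∈ P, ((T.filter fun t => t⁻¹ v ∈ J a).card : ℝ) / T.card ≤ 1 := by
  classical
  have hTc : (0 : ℝ) < T.card := by exact_mod_cast hT.card_pos
  rw [← Finset.sum_div, div_le_one hTc, ← Nat.cast_sum, Nat.cast_le]
  -- the events are pairwise disjoint subsets of `T`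
  have hdisj : (P : Set (Fin m)).PairwiseDisjoint fun a => T.filter fun t => t⁻¹ v ∈ J a := by
    intro a _ a' _ hne
    exact Finset.disjoint_filter.2 fun t _ ht ht' => Finset.disjoint_left.1 (hJ a a' hne) ht ht'
  rw [← Finset.card_biUnion hdisj]
  exact Finset.card_le_card (Finset.biUnion_subset.2 fun a _ => Finset.filter_subset _ _)

/-! ## The mass budget and the row sums of the hub masses -/

/-- **Budget of two sub-partitions of unity.** For a probability vector `μ` and nonnegative
families `X a, Y b` whose partial sums over the indices are pointwise `≤ 1`:
`Σ_{a ∈ P} Σ_v μ X_a + Σ_{b ∈ Q} Σ_v μ Y_b ≤ 1 + Σ_{a ∈ P} Σ_{b ∈ Q} Σ_v μ X_a Y_b`.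
Proof: with `A = Σ_P X_a`, `B = Σ_Q Y_b ∈ [0,1]` pointwise, the split constraint
`Σ μA + Σ μB - 1 ≤ Σ μAB` (`hubMass_ge_add_sub_one`), then expand `AB` and exchange sums.
[folklore] -/
theorem budget_of_subpartitions {n m : ℕ} (μ : Fin n → ℝ) (X Y : Fin m → Fin n → ℝ)
    (hμ0 : ∀ v, 0 ≤ μ v) (hμ1 : ∑ v, μ v = 1) (hX0 : ∀ a v, 0 ≤ X a v) (hY0 : ∀ b v, 0 ≤ Y b v)
    (hX1 : ∀ (P : Finset (Fin m)) v, ∑ a ∈ P, X a v ≤ 1)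
    (hY1 : ∀ (Q : Finset (Fin m)) v, ∑ b ∈ Q, Y b v ≤ 1) (P Q : Finset (Fin m)) :
    ∑ a ∈ P, ∑ v, μ v * X a v + ∑ b ∈ Q, ∑ v, μ v * Y b v ≤
      1 + ∑ a ∈ P, ∑ b ∈ Q, ∑ v, μ v * (X a v * Y b v) := by
  have _ := hX0 -- only the upper bounds on the partial sums are used
  have _ := hY0
  have h := hubMass_ge_add_sub_one μ (fun v => ∑ a ∈ P, X a v) (fun v => ∑ b ∈ Q, Y b v) hμ0 hμ1
    (fun v => hX1 P v) (fun v => hY1 Q v)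
  have e1 : ∑ a ∈ P, ∑ v, μ v * X a v = ∑ v, μ v * ∑ a ∈ P, X a v := by
    rw [Finset.sum_comm]
    simp_rw [Finset.mul_sum]
  have e2 : ∑ b ∈ Q, ∑ v, μ v * Y b v = ∑ v, μ v * ∑ b ∈ Q, Y b v := by
    rw [Finset.sum_comm]
    simp_rw [Finset.mul_sum]
  have e3 : ∑ a ∈ P, ∑ b ∈ Q, ∑ v, μ v * (X a v * Y b v) =
      ∑ v, μ v * ((∑ a ∈ P, X a v) * ∑ b ∈ Q, Y b v) := by
    simp_rw [Finset.sum_mul_sum, Finset.mul_sum]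
    symm
    rw [Finset.sum_comm]
    refine Finset.sum_congr rfl fun a _ => ?_
    rw [Finset.sum_comm]
  rw [e1, e2, e3]
  linarith

/-- **Row sums of the hub masses.** For `μ, X ≥ 0` and a nonnegative family `Y b` whose partial
sums are pointwise `≤ 1`: `Σ_b Σ_v μ X_a Y_b = Σ_v μ X_a (Σ_b Y_b) ≤ Σ_v μ X_a`. [folklore] -/
theorem hubMass_rowSum_le {n m : ℕ} (μ : Fin n → ℝ) (X Y : Fin m → Fin n → ℝ)
    (hμ0 : ∀ v, 0 ≤ μ v) (hX0 : ∀ a v, 0 ≤ X a v) (hY0 : ∀ b v, 0 ≤ Y b v)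
    (hY1 : ∀ (Q : Finset (Fin m)) v, ∑ b ∈ Q, Y b v ≤ 1) (a : Fin m) :
    ∑ b, ∑ v, μ v * (X a v * Y b v) ≤ ∑ v, μ v * X a v := by
  have _ := hY0 -- only the upper bound on the full sum of `Y` is used
  rw [Finset.sum_comm]
  refine Finset.sum_le_sum fun v _ => ?_
  have e : ∑ b, μ v * (X a v * Y b v) = μ v * X a v * ∑ b, Y b v := by
    rw [Finset.mul_sum]
    refine Finset.sum_congr rfl fun b _ => ?_
    ring
  rw [e]
  exact mul_le_of_le_one_right (mul_nonneg (hμ0 v) (hX0 a v)) (hY1 Finset.univ v)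

end Summit.MatrixMultiplication.MatrixMultiplication.Theorems.PolynomialSlack
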